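/-
Copyright (c) 2026 the pub-hodgecm-mathlib formalisation cell (harness21).  Prover seat hodgecm-mathlib-A-p19 (g26): T3′ P-2 row (R2²) «THE FREE ROW, TYPE (2)» — the HEAD (D4)
(road «S3-tree», crux H413).
-/
import Literature.NumberTheory.Rogawski1990.DepthZeroKappaTransferTypeTwoRowTwoPlace  -- FILE 1 (this seat): `ncard_selfDual_cyclic_typeTwo_eq_ite` (the one-place row value)
import Literature.NumberTheory.Rogawski1990.TypeTwoOnePlaceData                    -- ★ (D1) A-p12 (g22) ∕ F0P2-p01 (g14): `exists_typeTwo_onePlace_data`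
import Literature.NumberTheory.Rogawski1990.DepthZeroKappaTransferTypeTwoUnitRow     -- ★ p846128 O8d-2u: the binder currency of the type-(2) rows (brings ★ transport `ncard_fixedBy_rankStratum_eq_ncard_localNonsplitEquiv`)
import Literature.NumberTheory.Automorphic.DeepElementCyclicLatticeStable           -- ★ rider `ncard_fixedBy_unitary_rank_eq_ncard_free'`
import Literature.NumberTheory.Rogawski1990.UnitFundamentalLemmaInertFlickerFrame   -- ★ `isUnit_two_integer_iff_valued_eq_one`
import HarnessLib

/-!
# The depth-zero κ-transfer, type (2): ROW 2 — the free (regular-nilpotent) stratum of the two type-(2) classes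

Topic `NumberTheory/Rogawski1990`; namespace `Literature.NumberTheory.Rogawski1990`.  THEOREMS ONLY (no definition, no instance, no notation, no named fact, no `sorry`); kernel lane
`--supports stmt-HodgeConjecture-24833`.  Road «S3-tree», T3′ «DEPTH-ZERO κ-TRANSFER», P-2 clause `stub_T3prime_typeTwo` ((AS) A-p12 (g22)), row `hK₂` of ★ socket p846003:
  **`n₂(δ₊) − n₂(δ₋) = (−1)^n · (q+1) · q^{N+n−1}`** (`ncard_rankStrata_two_sub_eq_neg_one_pow_mul`), from the per-class value
  **`n₂(δ) = (q+1)·q^{N+n−1}` if `κ_v(γ_H, δ) = (−1)^n`, else `0`** (`ncard_rankStratum_two_typeTwo_eq_ite`).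
ASSEMBLY (architect A-p16 (g30) A-145∕A-152∕A-158): CM → one place (★ `ncard_fixedBy_rankStratum_eq_ncard_localNonsplitEquiv` ∘ ★ rider `ncard_fixedBy_unitary_rank_eq_ncard_free′`)
· ★ (D1) one-place data (A-p12 (g22)) · FILE 1 `ncard_selfDual_cyclic_typeTwo_eq_ite` (★ (D2-α∕β) F0P2-p06 (g11) · ★ (D2-γ∕γ-CM) B-p14 (g37) over ★ [T2-b] seam + core · ★ (D3)
bridge · ★ [T2-a] torsor count F0P3b-p01 (g12) · ★ [T2-c] unit index + ★ (D5) discharge F0P3a-p08 (g18)) · the κ-reading `κ = 1 ↔ ord_w d₀ even` of ★ (D1).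
HONEST LABEL: HC_CM is proved only modulo the 2 remaining named inputs (hLiu418 24832, h413 24833) until rung 0 closes; count-neutral.

## References
* [Rogawski1990] J. D. Rogawski, *Automorphic Representations of Unitary Groups in Three Variables* (1990): §4.9 Lemma 4.9.3 p. 56, Prop. 4.9.1 (b) p. 55.
* [Flicker1998UnitaryFL] Y. Z. Flicker, *Elementary proof of the fundamental lemma for a unitary group*, Canad. J. Math. 50 (1998): Props. 16–17 pp. 95–97.
* [Kottwitz1986] R. E. Kottwitz, *Base change for unit elements of Hecke algebras*, Compositio Math. 60 (1986): §3.
* [LanglandsShelstad1987] R. P. Langlands, D. Shelstad, *On the definition of transfer factors*, Math. Ann. 278 (1987): §1.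
-/

set_option autoImplicit false

noncomputable section

open NumberField IsDedekindDomain Matrix Polynomial Finset
open scoped MatrixGroups WithZero ValuativeRel

namespace Literature.NumberTheory.Rogawski1990

open ValuativeRel
open Literature.NumberTheory.Automorphic Literature.NumberTheory.Automorphic.UnitaryGroup
open Literature.NumberTheory.GaloisRepresentations Literature.NumberTheory.NumberFields

variable (L : Type) [Field L] [NumberField L] [IsCMField L] {v : HeightOneSpectrum (𝓞 ↥(maximalRealSubfield L))}

/-! ## The CM per-class value and the row -/

section CM

open Literature.NumberTheory.Automorphic.IntegralReduction

variable (H' : Matrix (Fin 3) (Fin 3) L)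

set_option synthInstance.maxHeartbeats 200000 in
set_option maxHeartbeats 800000 in
open scoped Classical in
/-- **ROW 2, ONE TYPE-(2) CLASS (CM currency).**  For a type-(2) `G`-regular `γ_H` at an inert `v ∤ 2` with `H′` hyperspecial at the CM place `w`, and a deep match `δ ∈ G′_v`
(`IsLocalNormPair`, `δ_w ≡ 1`), the regular-nilpotent stratum of the `δ`-fixed cosets counts `(q+1)·q^{N+n−1}` if `κ_v(γ_H, δ) = (−1)^n` and `0` otherwise:
★ transport ∘ ★ rider ∘ ★ (D1) ∘ `ncard_selfDual_cyclic_typeTwo_eq_ite` ∘ the κ-reading `κ = 1 ↔ ord_w d₀ even`.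
[cite: Rogawski1990, §4.9 Lemma 4.9.3 p. 56, Prop. 4.9.1 (b) p. 55] [cite: Kottwitz1986, §3] [cite: LanglandsShelstad1987, §1] -/
theorem ncard_rankStratum_two_typeTwo_eq_ite
    (hH' : (H'.map (IsCMField.complexConj L))ᵀ = H') (w : PlacesOver L v)
    (hw : IsCMField.complexConj L • w.1 = w.1) (hv : Algebra.IsUnramifiedIn (𝓞 L) v.asIdeal)
    (hH'w : IsUnit (placeForm H' w.1)) (hH'i : hH'w.unit ∈ glInt 3 (w.1.adicCompletion L))
    (h2 : IsUnit (2 : 𝒪[w.1.adicCompletion L]))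
    {γH : (cmDatum L 2 (Matrix.of fun i j : Fin 2 => if i.val + j.val + 1 = 2 then (1 : L) else 0)).Local v ×
      (cmDatum L 1 (Matrix.of fun i j : Fin 1 => if i.val + j.val + 1 = 1 then (1 : L) else 0)).Local v}
    (hreg : IsLocalGRegular L v γH)
    (hirr : ¬ ∃ x : w.1.adicCompletion L, (((γH.1.val : GL (Fin 2) (LocalRing L v)).val.map
      (Pi.evalRingHom (fun w' : PlacesOver L v => w'.1.adicCompletion L) w)).charpoly).IsRoot x)
    (n N : ℕ)
    (hn : Valued.v (((finCharpolyTwo L v γH).eval (finGammaTwo L v γH)) w) = WithZero.exp (-(n : ℤ)))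
    (hN : Valued.v (((γH.1.val : GL (Fin 2) (LocalRing L v)).val.map
        (Pi.evalRingHom (fun w' : PlacesOver L v => w'.1.adicCompletion L) w)).trace ^ 2 -
        4 * ((γH.1.val : GL (Fin 2) (LocalRing L v)).val.map
        (Pi.evalRingHom (fun w' : PlacesOver L v => w'.1.adicCompletion L) w)).det) = WithZero.exp (-((2 * N + 1 : ℕ) : ℤ)))
    (hNn : 1 ≤ N + n)
    {δ : (cmDatum L 3 H').Local v} (hδ : IsLocalNormPair L H' v γH δ)
    (ht : ∀ m : ℕ, ValuativeRel.valuation (w.1.adicCompletion L)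
      (((((δ.val : GL (Fin 3) (LocalRing L v)).val.map
        (Pi.evalRingHom (fun w' : UnitaryGroup.PlacesOver L v => w'.1.adicCompletion L) w))).charpoly - (Polynomial.X - 1) ^ 3).coeff m) < 1) :
    (({q : (cmDatum L 3 H').Local v ⧸ cmLocalIntegralLevel L 3 H' v |
        q ∈ MulAction.fixedBy ((cmDatum L 3 H').Local v ⧸ cmLocalIntegralLevel L 3 H' v) δ ∧
          (redMat ((((q.out⁻¹ * δ * q.out : (cmDatum L 3 H').Local v)).val : GL (Fin 3) (LocalRing L v)).val.map
            (Pi.evalRingHom (fun w' : UnitaryGroup.PlacesOver L v => w'.1.adicCompletion L) w)) - 1).rank = 2}.ncard : ℕ) : ℚ) =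
      if (finKappaAt L v H' γH δ = 1 ↔ Even n) then
        (((Ideal.absNorm v.asIdeal + 1) * Ideal.absNorm v.asIdeal ^ (N + n - 1) : ℕ) : ℚ) else 0 := by
  classical
  haveI : Algebra.IsQuadraticExtension ↥(maximalRealSubfield L) L := IsCMField.isQuadraticExtension L
  have hc1 : IsCMField.complexConj L ≠ 1 := IsCMField.complexConj_ne_one L
  -- Step 1: the stratum as a count of self-dual `δ_w`-cyclic lattices (★ transport ∘ ★ rider)
  rw [ncard_fixedBy_rankStratum_eq_ncard_localNonsplitEquiv L 3 H' v w hw δ 2]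
  have hrid := ncard_fixedBy_unitary_rank_eq_ncard_free' (galAdicCompletionMap (L := L) (IsCMField.complexConj L) hw) hH'w.unit
    (localNonsplitEquiv (IsCMField.complexConj L) H' hc1 w hw δ) ht
  simp only [show (3 : ℕ) - 1 = 2 from rfl] at hrid
  refine (congrArg (fun m : ℕ => (m : ℚ)) hrid).trans ?_
  have hcoe : (((localNonsplitEquiv (IsCMField.complexConj L) H' hc1 w hw δ :
      ↥(unitaryGroupOfForm (galAdicCompletionMap (L := L) (IsCMField.complexConj L) hw) (placeForm H' w.1))) :
        GL (Fin 3) (w.1.adicCompletion L)) : Matrix (Fin 3) (Fin 3) (w.1.adicCompletion L)) =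
      ((δ.val : GL (Fin 3) (LocalRing L v)) : Matrix (Fin 3) (Fin 3) (LocalRing L v)).map
        (Pi.evalRingHom (fun w' : PlacesOver L v => w'.1.adicCompletion L) w) := rfl
  simp only [hcoe]
  -- Step 2: ★ (D1) the one-place data, and the one-place value
  obtain ⟨u, t, D, w₀, x₀, -, -, -, -, -, -, hχ, -, -, -, hτU, hσu, hσD, hσt, hn', hdisc, hu1, ht2, -, -, hK, hx₀0, hx₀, -, -, hκ⟩ :=
    exists_typeTwo_onePlace_data L H' hH' w hw hv hH'w hreg hirr n N hn hN hδ ht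
  -- integrality of `charpoly δ_w` in the `ValuativeRel` currency (★ `charpoly_coeff_mem_integer_of_deep`; ★ (D1) states it in the `Valued` currency)
  have hint : ∀ i : ℕ, ((((δ.val : GL (Fin 3) (LocalRing L v)) : Matrix (Fin 3) (Fin 3) (LocalRing L v)).map
      (Pi.evalRingHom (fun w' : PlacesOver L v => w'.1.adicCompletion L) w))).charpoly.coeff i ∈ 𝒪[w.1.adicCompletion L] := fun i => by
    rw [← hcoe]
    exact charpoly_coeff_mem_integer_of_deep
      ((localNonsplitEquiv (IsCMField.complexConj L) H' hc1 w hw δ :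
        ↥(unitaryGroupOfForm (galAdicCompletionMap (L := L) (IsCMField.complexConj L) hw) (placeForm H' w.1))) :
          GL (Fin 3) (w.1.adicCompletion L)) ht i
  have hv2 : Valued.v (2 : w.1.adicCompletion L) = 1 := (isUnit_two_integer_iff_valued_eq_one (L := L) w.1).1 h2
  have hJh : ((((hH'w.unit : GL (Fin 3) (w.1.adicCompletion L)) : Matrix (Fin 3) (Fin 3) (w.1.adicCompletion L))).map
      (galAdicCompletionMap (L := L) (IsCMField.complexConj L) hw))ᵀ = (hH'w.unit : GL (Fin 3) (w.1.adicCompletion L)) :=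
    placeForm_hermitian_of_smul_eq (IsCMField.complexConj L) w H' hH' hw
  have hval := ncard_selfDual_cyclic_typeTwo_eq_ite L w hw hv hv2 hH'w.unit hH'i hJh
    (((δ.val : GL (Fin 3) (LocalRing L v)) : Matrix (Fin 3) (Fin 3) (LocalRing L v)).map (Pi.evalRingHom (fun w' : PlacesOver L v => w'.1.adicCompletion L) w))
    hτU hint hχ hσu hσD hσt hu1 ht2 hn' hdisc hNn hK hx₀ hx₀0
  rw [hval, IsUnit.unit_spec, Finset.sum_comm]
  -- Step 3: the κ-reading
  have hiff : Even (WithZero.log (Valued.v (∑ i : Fin 3, ∑ k : Fin 3, galAdicCompletionMap (L := L) (IsCMField.complexConj L) hw (x₀ i) *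
      placeForm H' w.1 i k * x₀ k)) + (n : ℤ)) ↔ (finKappaAt L v H' γH δ = 1 ↔ Even n) := by
    rw [Int.even_add, Int.even_coe_nat, hκ]
  by_cases hE : Even (WithZero.log (Valued.v (∑ i : Fin 3, ∑ k : Fin 3, galAdicCompletionMap (L := L) (IsCMField.complexConj L) hw (x₀ i) *
      placeForm H' w.1 i k * x₀ k)) + (n : ℤ))
  · rw [if_pos hE, if_pos (hiff.1 hE)]
  · rw [if_neg hE, if_neg (fun h => hE (hiff.2 h))]
    simp

set_option synthInstance.maxHeartbeats 200000 in
set_option maxHeartbeats 400000 in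
open scoped Classical in
/-- **THE FREE ROW OF THE TYPE-(2) SOCKET** (`hK₂` of ★ `finsum_finExplicitDelta_mul_classOrbitalIntegral_eq_of_irreducible_of_strata` with `np := n(δ₊)`, `nm := n(δ₋)`):
for deep matches `δ₊`, `δ₋` of a `G`-regular type-(2) `γ_H` (`χ_g` irreducible over `L_w`) with `κ_v(γ_H, δ_±) = ±1`, observable exponents `n`, `N ≥ 1`,
`n₂(δ₊) − n₂(δ₋) = (−1)^n · (q+1) · q^{N+n−1}` — the regular-nilpotent stratum is the set of self-dual `δ_w`-cyclic lattices, a torsor count `[C : R^×]` on exactly one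
of the two classes (the one with `κ = (−1)^n`), and `[C : R^×] = (q+1)q^{N+n−1}` for the order `𝒪_w[δ_w] ⊂ L_w × K₁`.
[cite: Rogawski1990, §4.9 Lemma 4.9.3 p. 56, Prop. 4.9.1 (b) p. 55] [cite: Flicker1998UnitaryFL, Props. 16–17 pp. 95–97] [cite: Kottwitz1986, §3] -/
theorem ncard_rankStrata_two_sub_eq_neg_one_pow_mul
    (hH' : (H'.map (IsCMField.complexConj L))ᵀ = H') (w : PlacesOver L v)
    (hw : IsCMField.complexConj L • w.1 = w.1) (hv : Algebra.IsUnramifiedIn (𝓞 L) v.asIdeal)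
    (hH'w : IsUnit (placeForm H' w.1)) (hH'i : hH'w.unit ∈ glInt 3 (w.1.adicCompletion L))
    (h2 : IsUnit (2 : 𝒪[w.1.adicCompletion L]))
    {γH : (cmDatum L 2 (Matrix.of fun i j : Fin 2 => if i.val + j.val + 1 = 2 then (1 : L) else 0)).Local v ×
      (cmDatum L 1 (Matrix.of fun i j : Fin 1 => if i.val + j.val + 1 = 1 then (1 : L) else 0)).Local v}
    (hreg : IsLocalGRegular L v γH)
    (hirr : ¬ ∃ x : w.1.adicCompletion L, (((γH.1.val : GL (Fin 2) (LocalRing L v)).val.map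
        (Pi.evalRingHom (fun w' : PlacesOver L v => w'.1.adicCompletion L) w)).charpoly).IsRoot x)
    (n N : ℕ)
    (hn : Valued.v (((finCharpolyTwo L v γH).eval (finGammaTwo L v γH)) w) = WithZero.exp (-(n : ℤ)))
    (hN : Valued.v (((γH.1.val : GL (Fin 2) (LocalRing L v)).val.map
        (Pi.evalRingHom (fun w' : PlacesOver L v => w'.1.adicCompletion L) w)).trace ^ 2 -
      4 * ((γH.1.val : GL (Fin 2) (LocalRing L v)).val.map
        (Pi.evalRingHom (fun w' : PlacesOver L v => w'.1.adicCompletion L) w)).det) = WithZero.exp (-((2 * N + 1 : ℕ) : ℤ)))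
    (hN1 : 1 ≤ N)
    (δp : (cmDatum L 3 H').Local v) (hp : IsLocalNormPair L H' v γH δp) (hκp : finKappaAt L v H' γH δp = 1)
    (htp : ∀ m : ℕ, ValuativeRel.valuation (w.1.adicCompletion L)
      (((((δp.val : GL (Fin 3) (LocalRing L v)).val.map (Pi.evalRingHom (fun w' : UnitaryGroup.PlacesOver L v => w'.1.adicCompletion L) w))).charpoly -
        (Polynomial.X - 1) ^ 3).coeff m) < 1)
    (δm : (cmDatum L 3 H').Local v) (hm : IsLocalNormPair L H' v γH δm) (hκm : finKappaAt L v H' γH δm = -1)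
    (htm : ∀ m : ℕ, ValuativeRel.valuation (w.1.adicCompletion L)
      (((((δm.val : GL (Fin 3) (LocalRing L v)).val.map (Pi.evalRingHom (fun w' : UnitaryGroup.PlacesOver L v => w'.1.adicCompletion L) w))).charpoly -
        (Polynomial.X - 1) ^ 3).coeff m) < 1) :
    (({q : (cmDatum L 3 H').Local v ⧸ cmLocalIntegralLevel L 3 H' v |
            q ∈ MulAction.fixedBy ((cmDatum L 3 H').Local v ⧸ cmLocalIntegralLevel L 3 H' v) δp ∧
              (redMat ((((q.out⁻¹ * δp * q.out : (cmDatum L 3 H').Local v)).val : GL (Fin 3) (LocalRing L v)).val.map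
                (Pi.evalRingHom (fun w' : UnitaryGroup.PlacesOver L v => w'.1.adicCompletion L) w)) - 1).rank = 2}.ncard : ℕ) : ℚ) -
      (({q : (cmDatum L 3 H').Local v ⧸ cmLocalIntegralLevel L 3 H' v |
            q ∈ MulAction.fixedBy ((cmDatum L 3 H').Local v ⧸ cmLocalIntegralLevel L 3 H' v) δm ∧
              (redMat ((((q.out⁻¹ * δm * q.out : (cmDatum L 3 H').Local v)).val : GL (Fin 3) (LocalRing L v)).val.map
                (Pi.evalRingHom (fun w' : UnitaryGroup.PlacesOver L v => w'.1.adicCompletion L) w)) - 1).rank = 2}.ncard : ℕ) : ℚ) =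
      (-1 : ℚ) ^ n * ((Ideal.absNorm v.asIdeal : ℚ) + 1) * (Ideal.absNorm v.asIdeal : ℚ) ^ (N + n - 1) := by
  have hNn : 1 ≤ N + n := by omega
  rw [ncard_rankStratum_two_typeTwo_eq_ite L H' hH' w hw hv hH'w hH'i h2 hreg hirr n N hn hN hNn hp htp,
    ncard_rankStratum_two_typeTwo_eq_ite L H' hH' w hw hv hH'w hH'i h2 hreg hirr n N hn hN hNn hm htm, hκp, hκm]
  rcases Nat.even_or_odd n with hev | hodd
  · have h1 : ((1 : ℤ) = 1 ↔ Even n) := ⟨fun _ => hev, fun _ => rfl⟩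
    have h2' : ¬ ((-1 : ℤ) = 1 ↔ Even n) := fun h => absurd (h.2 hev) (by decide)
    rw [if_pos h1, if_neg h2', hev.neg_one_pow]
    push_cast
    ring
  · have h1 : ¬ ((1 : ℤ) = 1 ↔ Even n) := fun h => (Nat.not_even_iff_odd.2 hodd) (h.1 rfl)
    have h2' : ((-1 : ℤ) = 1 ↔ Even n) := ⟨fun h => absurd h (by decide), fun h => absurd h (Nat.not_even_iff_odd.2 hodd)⟩
    rw [if_neg h1, if_pos h2', hodd.neg_one_pow]
    push_cast
    ring

end CM

end Literature.NumberTheory.Rogawski1990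

end
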